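import Literature.NumberTheory.Automorphic.UnitaryLatticeTreeEulerRelation          -- ★ root star = `K₀·N₁`, fixed-coset dictionary, `mapGL_conj_stdLattice_eq_iff`
import Literature.NumberTheory.Automorphic.UnitaryThreeFourFrameFixedCosetDictionary  -- ★ `natCard_fixedBy_quotient_eq_ncard_orbit` (`#Fix_γ(G⧸Stab N₀) = #{M ∈ G·N₀ | γ·M = M}`)
import HarnessLib

/-!
# R90 · S6 «Ch. 14.1–14.5 stable trace formula» — card W8-i″, FILE 2 (THE BRIDGE): the `k`-fixed points of the star `K₀ ⧸ I_{K₀}` of the hyperspecial root are the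
# `k`-fixed SPECIAL NEIGHBOURS of the root in the `U(3)` lattice tree (`Theorems/R90S6ResidualStarFixedPoints.lean`)

Cell `hodgecm-mathlib`, crux H413 (`stmt-HodgeConjecture-24833`), route of record `HCCMUnconditional`; programme R90-TF, section S6 (base `R90-C14`), seat R90-C14-p05 (g0);
S6 dealer R90-C14-plan (g2) 23:57:28Z «W8-i″ FILE 2 = THE BRIDGE … so consumers never inherit the slow carrier» (DAG r5 row E1.3.5.2.4).  Helper lane
`--supports stmt-HodgeConjecture-24833 --as helper`; ONE theorem (no definition, no instance, no notation, no named fact, no `sorry`); imports = ★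
`Literature.NumberTheory.Automorphic.UnitaryLatticeTreeEulerRelation` + ★ `Literature.NumberTheory.Automorphic.UnitaryThreeFourFrameFixedCosetDictionary` + HarnessLib.

THE MATHEMATICS [BruhatTits1972, (4.4.4), §10; Serre1980Trees, II.1.1; Kottwitz1988, §2].  `K` a valued field with an unramified datum `hd : UnramifiedLocalConjDatum σ ϖ`,
`U = U(σ, J₀)(K)`, `K₀ = U ∩ GL₃(𝒪) = Stab_U(L₀)` (`L₀ = 𝒪³` the self-dual root), `K₁ = Stab_U(N₁)` (`N₁ = g₁·L₀`, `g₁ = diag(1,1,ϖ)`, the standard special neighbour),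
`I = K₀ ⊓ K₁`.  For `k ∈ K₀`, the `k`-fixed cosets of `K₀ ⧸ I_{K₀}` (the summand `s(x) = #Fix_{k_x}(K₀ ⧸ I_{K₀})` of ★ FILE 1 `R90.S6.natCard_fixedBy_special_add_eq_one_add_sum`
at `k = k_x`) correspond to the `k`-fixed lattices of the orbit `K₀·N₁` (★ dictionary `natCard_fixedBy_quotient_eq_ncard_orbit`, `I_{K₀} = Stab_{K₀}(N₁)` by ★
`mapGL_stdLattice_eq_iff_mem_glInt` + ★ `mapGL_conj_stdLattice_eq_iff`), and `K₀·N₁` IS the star of the root (★ `mem_neighborSet_root_iff_exists_mem_unitaryInt`):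
**`#Fix_k(K₀ ⧸ I_{K₀}) = #{w ∈ star(L₀) | k·w = w}`** in ★ `latticeGraph σ ϖ J₀` ∕ ★ `latticeGraphIso` currency — the input of the residual fixed-star test ★
`UnitaryLatticeTreeFixedStar.mapGL_mul_N₁_eq_iff` and of the star ≃ isotropic-points bijection ★ `natCard_neighborSet_root_eq` (FILE 3: the values `0, 1, q+1, q³+1` by the
residual type of `k̄`).
HONEST LABEL: coset ∕ lattice bookkeeping over ★ organs; count-neutral until the E1.3.5.2.4 residual censuses + W8-f consume it; proves no printed statement.  HC_CM is proved only
modulo the 7 printed citations (2 remaining named inputs: hLiu418 = stmt-HodgeConjecture-24832, h413 = stmt-HodgeConjecture-24833) until rung 0 closes.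
-/

set_option autoImplicit false
-- the mandated namespace repeats the single-problem summit's segment (`HodgeConjecture.HodgeConjecture`)
set_option linter.dupNamespace false

noncomputable section

open MulAction
open Literature.NumberTheory.Automorphic Literature.NumberTheory.Automorphic.HermitianLattice Literature.NumberTheory.Automorphic.UnitaryGroup
open Literature.NumberTheory.Automorphic.UnitaryLatticeTree Literature.NumberTheory.Automorphic.UnitaryThreeFourFrame Literature.NumberTheory.Automorphic.CartanUnique
open scoped Matrix MatrixGroups WithZero Valued

namespace Summit.HodgeConjecture.HodgeConjecture.R90.S6

set_option synthInstance.maxHeartbeats 400000 in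
-- the `MulAction ↥K₀ (↥K₀ ⧸ I_{K₀})` instance behind ★ FILE 1's fibre carrier needs > 20 000 synthesis heartbeats at `U(Φ₃)` (found in ≈ 1 s); last occurrence — the RHS is lattice currency
/-- **W8-i″ FILE 2 — THE BRIDGE: `#Fix_k(K₀ ⧸ I_{K₀}) = #{special neighbours of the root fixed by k}`.**  For an unramified datum `hd`, `g₁ = diag(1,1,ϖ)` and `k ∈ K₀ =
U(σ,J₀) ∩ GL₃(𝒪)`, the number of `k`-fixed cosets of `K₀ ⧸ (K₀ ⊓ K₁)_{K₀}` (`K₁ = Stab(g₁·L₀)`; the summand of ★ `R90.S6.natCard_fixedBy_special_add_eq_one_add_sum`) equals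
the number of vertices `w` of the star of the root `L₀ = 𝒪³` in ★ `latticeGraph σ ϖ J₀` with `latticeGraphIso σ ϖ J₀ k w = w` — via the ★ fixed-coset dictionary at
`(G, N₀, Stab) = (K₀, N₁, I_{K₀})` and ★ `star(L₀) = K₀·N₁`. [cite: BruhatTits1972, (4.4.4) and §10] [cite: Serre1980Trees, II.1.1] [cite: Kottwitz1988, §2] -/
theorem natCard_fixedBy_star_eq_ncard_fixed_neighborSet_root {K : Type*} [Field K] [Valued K ℤᵐ⁰] [ValuativeRel K] [(Valued.v : Valuation K ℤᵐ⁰).Compatible]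
    {σ : K →+* K} {ϖ : K} (hd : UnramifiedLocalConjDatum σ ϖ)
    (g₁ : GL (Fin 3) K) (hg₁ : (g₁ : Matrix (Fin 3) (Fin 3) K) = Matrix.diagonal ![(1 : K), 1, ϖ])
    (k : ↥(unitaryGroupOfForm σ ((StdForm.antidiagonal 3).over K)))
    (hk : k ∈ (glInt 3 K).subgroupOf (unitaryGroupOfForm σ ((StdForm.antidiagonal 3).over K))) :
    Nat.card (fixedBy (↥((glInt 3 K).subgroupOf (unitaryGroupOfForm σ ((StdForm.antidiagonal 3).over K))) ⧸
        (((glInt 3 K).subgroupOf (unitaryGroupOfForm σ ((StdForm.antidiagonal 3).over K)) ⊓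
          ((glInt 3 K).map (MulAut.conj g₁).toMonoidHom).subgroupOf (unitaryGroupOfForm σ ((StdForm.antidiagonal 3).over K))).subgroupOf
          ((glInt 3 K).subgroupOf (unitaryGroupOfForm σ ((StdForm.antidiagonal 3).over K)))))
        (⟨k, hk⟩ : ↥((glInt 3 K).subgroupOf (unitaryGroupOfForm σ ((StdForm.antidiagonal 3).over K))))) =
      {w : {M : Submodule 𝒪[K] (Fin 3 → K) // IsVertex σ ϖ ((StdForm.antidiagonal 3).over K) M} |
        w ∈ (latticeGraph σ ϖ ((StdForm.antidiagonal 3).over K)).neighborSet ⟨stdLattice K 3, 0, isSelfDualLattice_stdLattice_three hd⟩ ∧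
          latticeGraphIso σ ϖ ((StdForm.antidiagonal 3).over K) k w = w}.ncard := by
  classical
  have hϖ0 : ϖ ≠ 0 := uniformizer_ne_zero hd.vϖ
  have hϖ1 : Valued.v ϖ ≤ 1 := uniformizer_mem_integer hd.vϖ
  -- the standard special neighbour `N₁ = g₁·L₀ = latt diag(1,1,ϖ)`, a type-two vertex
  have hN₁ : mapGL g₁ (stdLattice K 3) = latt (Matrix.diagonal ![(1 : K), 1, ϖ]) := by rw [← hg₁]; rfl
  have hN₁v : IsVertexLattice σ ϖ ((StdForm.antidiagonal 3).over K) 2 (mapGL g₁ (stdLattice K 3)) := by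
    rw [hN₁]; exact isVertexLattice_two_latt_diagonal_one_one hd.σϖ hϖ1 hϖ0
  -- the inclusion `ι : K₀ →* GL₃(K)` and the stabiliser dictionary `u ∈ I_{K₀} ↔ ι(u)·N₁ = N₁`
  have hKt : ∀ u : ↥((glInt 3 K).subgroupOf (unitaryGroupOfForm σ ((StdForm.antidiagonal 3).over K))),
      u ∈ (((glInt 3 K).subgroupOf (unitaryGroupOfForm σ ((StdForm.antidiagonal 3).over K)) ⊓
          ((glInt 3 K).map (MulAut.conj g₁).toMonoidHom).subgroupOf (unitaryGroupOfForm σ ((StdForm.antidiagonal 3).over K))).subgroupOf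
          ((glInt 3 K).subgroupOf (unitaryGroupOfForm σ ((StdForm.antidiagonal 3).over K)))) ↔
        mapGL (((unitaryGroupOfForm σ ((StdForm.antidiagonal 3).over K)).subtype.comp
          ((glInt 3 K).subgroupOf (unitaryGroupOfForm σ ((StdForm.antidiagonal 3).over K))).subtype) u) (mapGL g₁ (stdLattice K 3)) =
          mapGL g₁ (stdLattice K 3) := by
    intro u
    rw [Subgroup.mem_subgroupOf, Subgroup.mem_inf, and_iff_right u.2, Subgroup.mem_subgroupOf, Subgroup.mem_map_equiv, MulAut.conj_symm_apply,
      ← mapGL_stdLattice_eq_iff_mem_glInt, mapGL_conj_stdLattice_eq_iff]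
    rfl
  rw [natCard_fixedBy_quotient_eq_ncard_orbit
    ((unitaryGroupOfForm σ ((StdForm.antidiagonal 3).over K)).subtype.comp
      ((glInt 3 K).subgroupOf (unitaryGroupOfForm σ ((StdForm.antidiagonal 3).over K))).subtype)
    (mapGL g₁ (stdLattice K 3)) _ hKt ⟨k, hk⟩]
  -- the orbit `K₀·N₁` is the star of the root; transport the count along `w ↦ w.1`
  have hset : {M : Submodule 𝒪[K] (Fin 3 → K) |
      (∃ u : ↥((glInt 3 K).subgroupOf (unitaryGroupOfForm σ ((StdForm.antidiagonal 3).over K))),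
        mapGL (((unitaryGroupOfForm σ ((StdForm.antidiagonal 3).over K)).subtype.comp
          ((glInt 3 K).subgroupOf (unitaryGroupOfForm σ ((StdForm.antidiagonal 3).over K))).subtype) u) (mapGL g₁ (stdLattice K 3)) = M) ∧
      mapGL (((unitaryGroupOfForm σ ((StdForm.antidiagonal 3).over K)).subtype.comp
          ((glInt 3 K).subgroupOf (unitaryGroupOfForm σ ((StdForm.antidiagonal 3).over K))).subtype) ⟨k, hk⟩) M = M} =
      Subtype.val '' {w : {M : Submodule 𝒪[K] (Fin 3 → K) // IsVertex σ ϖ ((StdForm.antidiagonal 3).over K) M} |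
        w ∈ (latticeGraph σ ϖ ((StdForm.antidiagonal 3).over K)).neighborSet ⟨stdLattice K 3, 0, isSelfDualLattice_stdLattice_three hd⟩ ∧
          latticeGraphIso σ ϖ ((StdForm.antidiagonal 3).over K) k w = w} := by
    ext M
    simp only [Set.mem_setOf_eq, Set.mem_image, MonoidHom.coe_comp, Subgroup.coe_subtype, Function.comp_apply]
    constructor
    · rintro ⟨⟨u, rfl⟩, hM⟩
      have hκ : (u : ↥(unitaryGroupOfForm σ ((StdForm.antidiagonal 3).over K))) ∈ unitaryInt σ ((StdForm.antidiagonal 3).over K) := by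
        rw [mem_unitaryInt_iff]
        exact (Literature.NumberTheory.Automorphic.mem_glInt_iff_forall_v_le_one _).1 (Subgroup.mem_subgroupOf.1 u.2)
      have hv : IsVertex σ ϖ ((StdForm.antidiagonal 3).over K)
          (mapGL ((u : ↥(unitaryGroupOfForm σ ((StdForm.antidiagonal 3).over K))) : GL (Fin 3) K) (mapGL g₁ (stdLattice K 3))) :=
        ⟨2, isVertexLattice_mapGL σ ϖ _ _ (u : ↥(unitaryGroupOfForm σ ((StdForm.antidiagonal 3).over K))).2 hN₁v⟩
      refine ⟨⟨_, hv⟩, ⟨?_, ?_⟩, rfl⟩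
      · rw [mem_neighborSet_root_iff_exists_mem_unitaryInt hd]
        exact ⟨u, hκ, by rw [← hN₁]⟩
      · rw [latticeGraphIso_apply_eq_self_iff]
        exact hM
    · rintro ⟨w, ⟨hw, hfix⟩, rfl⟩
      obtain ⟨κ, hκ, hw1⟩ := (mem_neighborSet_root_iff_exists_mem_unitaryInt hd w).1 hw
      have hκ' : κ ∈ (glInt 3 K).subgroupOf (unitaryGroupOfForm σ ((StdForm.antidiagonal 3).over K)) := by
        rw [Subgroup.mem_subgroupOf, Literature.NumberTheory.Automorphic.mem_glInt_iff_forall_v_le_one]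
        exact mem_unitaryInt_iff.1 hκ
      refine ⟨⟨⟨κ, hκ'⟩, ?_⟩, ?_⟩
      · rw [hw1, hN₁]
      · exact (latticeGraphIso_apply_eq_self_iff σ ϖ _ k w).1 hfix
  rw [hset, Set.ncard_image_of_injective _ Subtype.val_injective]

end Summit.HodgeConjecture.HodgeConjecture.R90.S6

end
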